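import Mathlib.Analysis.Calculus.MeanValue
import Mathlib.Analysis.Calculus.ParametricIntegral
import Mathlib.Analysis.SpecialFunctions.ExpDeriv
import Literature.Analysis.OperatorTheory.PositiveKernelTransferOperator
import HarnessLib

/-!
# Operator-norm differentiability of a family of integral operators from a second-order bound on
# the kernels (Taylor remainder of the kernel ⟹ `HasDerivAt` of the operators)

Analysis/OperatorTheory proofs-layer file (theorems only; no definition, no named fact), companion of
`PositiveKernelTransferOperator.lean` (integral operators `(Aφ)(x) = ∫ K(x,y) φ(y) dμ(y)` of bounded
measurable kernels on `L²` of a finite measure space, given IMPLICITLY by the a.e. kernel formula) and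
of `TopEigenvalueDerivativeGap.lean` (the top eigenvalue of an operator family that is differentiable
IN OPERATOR NORM is differentiable at a spectral gap). This file supplies the operator-norm
differentiability for kernel families:

* §1 `abs_sub_sub_mul_le_of_abs_deriv_two_le` — scalar second-order Taylor bound by two applications of
  the mean value inequality: `|f t - f t₀ - (t-t₀) f′(t₀)| ≤ R (t-t₀)²` when `|f″| ≤ R` on the interval.
* §2 `hasDerivAt_integral_exp_mul_pow` — `d/dJ ∫ e^{J q} qⁿ dν = ∫ e^{J q} qⁿ⁺¹ dν` for bounded `q` on a
  finite measure space (dominated convergence), with the bound `abs_integral_exp_mul_pow_le`; the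
  building block of transfer kernels `∫ e^{J·(plaquette sum)} d(links)`.
* §3 `opNorm_le_of_kernel_bound` — `‖A‖ ≤ C·μ(X)` when `|K| ≤ C`; `kernelOp_taylor_ae_eq` — the
  remainder operator `T t - T t₀ - (t-t₀)•T′` has the remainder kernel; and the theorem
  `hasDerivAt_kernelOp_of_remainder_bound`: if `|K_t(x,y) - K_{t₀}(x,y) - (t-t₀) K′(x,y)| ≤ R (t-t₀)²`
  uniformly in `(x,y)` for `t` near `t₀` (e.g. from `§1`), then `HasDerivAt T T′ t₀` in operator norm for
  any operators `T t`, `T′` with these kernels; `hasDerivAt_kernelOp_of_abs_deriv_two_le` — the same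
  from kernel derivatives `∂K`, `∂²K` with `|∂²K| ≤ R`.

Printed anchor: Kato's "differentiability at a point" of an operator family means `T(ϰ) = T + ϰT′ + o(ϰ)`
with an OPERATOR-valued `o(ϰ)` (II-§5.4, footnote to Theorem 5.4: "`o(ϰ)` denotes an operator-valued
function `F(ϰ)` such that `‖F(ϰ)‖ = o(ϰ)` in the ordinary sense"); for integral operators Kato estimates
operator norms by kernel bounds (III-§2.1, Example 2.4 / (2.10): `‖T‖ ≤ (M′M″)^{1/2}` from row/column
bounds of the kernel — here the finite-measure special case `‖T‖ ≤ sup|K|·μ(X)`).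

## Mathlib / tree search

Mathlib: `Convex.norm_image_sub_le_of_norm_hasDerivWithin_le` (mean value inequality),
`hasDerivAt_integral_of_dominated_loc_of_deriv_le`, `MeasureTheory.Lp.norm_le_of_ae_bound`,
`hasDerivAt_iff_isLittleO`, `Asymptotics.isLittleO_pow_sub_sub`. Tree: `PositiveKernelTransferOperator`
(`abs_integral_kernel_mul_le`, `integrable_kernel_mul_coeFn`, `exists_kernelOp`);
`PositiveKernelNormLogConvex.hasDerivAt_inner_kernelOp'` (WEAK differentiability `d/dt ⟪φ, T_t ψ⟫`, which
does not give operator-norm differentiability); nothing on operator-norm derivatives of kernel families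
(`lean search 'hasDerivAt_kernelOp|opNorm_le_of_kernel'`: none).

## References

* T. Kato, *Perturbation Theory for Linear Operators*, Springer 1966: II-§5.4 Theorem 5.4 and its
  footnote (operator-valued `o(ϰ)`) (held copy chunk p0146); III-§2.1 Example 2.4 (integral operators
  bounded by kernel estimates). [Kato1966]
-/

noncomputable section

open MeasureTheory Set Filter Topology Asymptotics Function
open scoped ENNReal NNReal

namespace Literature.Analysis.OperatorTheory

/-! ## 1. Scalar second-order Taylor bound by the mean value inequality -/

section Scalar

/-- **Second-order Taylor bound from a bound on the second derivative** (two applications of the mean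
value inequality): if `f` has derivative `f′` and `f′` has derivative `f″` on `[t₀ - r, t₀ + r]` with
`|f″| ≤ R` there, then `|f t - f t₀ - (t - t₀) f′(t₀)| ≤ R (t - t₀)²` on that interval. (The sharp
constant `R/2` is not needed downstream.) [cite: Kato1966, II-§5.4 Theorem 5.4 footnote (o(ϰ) in the
ordinary sense); mean value inequality folklore] -/
theorem abs_sub_sub_mul_le_of_abs_deriv_two_le {f f' f'' : ℝ → ℝ} {t₀ r R : ℝ}
    (hf : ∀ t ∈ Icc (t₀ - r) (t₀ + r), HasDerivAt f (f' t) t)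
    (hf' : ∀ t ∈ Icc (t₀ - r) (t₀ + r), HasDerivAt f' (f'' t) t)
    (hR : ∀ t ∈ Icc (t₀ - r) (t₀ + r), |f'' t| ≤ R) {t : ℝ} (ht : t ∈ Icc (t₀ - r) (t₀ + r)) :
    |f t - f t₀ - (t - t₀) * f' t₀| ≤ R * (t - t₀) ^ 2 := by
  have ht₀ : t₀ ∈ Icc (t₀ - r) (t₀ + r) := ⟨by linarith [ht.1, ht.2], by linarith [ht.1, ht.2]⟩
  -- step 1: `|f' τ - f' t₀| ≤ R |τ - t₀|` on the interval
  have hL : ∀ τ ∈ Icc (t₀ - r) (t₀ + r), |f' τ - f' t₀| ≤ R * |τ - t₀| := by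
    intro τ hτ
    have h := Convex.norm_image_sub_le_of_norm_hasDerivWithin_le (f := f') (f' := f'')
      (fun x hx => (hf' x hx).hasDerivWithinAt) (fun x hx => by rw [Real.norm_eq_abs]; exact hR x hx)
      (convex_Icc _ _) ht₀ hτ
    simpa only [Real.norm_eq_abs] using h
  -- step 2: `g τ = f τ - (τ - t₀) f' t₀` has derivative `f' τ - f' t₀`, bounded by `R|t - t₀|` on `[t₀, t]`
  have hsub : uIcc t₀ t ⊆ Icc (t₀ - r) (t₀ + r) := uIcc_subset_Icc ht₀ ht
  have hg : ∀ τ ∈ uIcc t₀ t, HasDerivWithinAt (fun τ => f τ - (τ - t₀) * f' t₀) (f' τ - f' t₀)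
      (uIcc t₀ t) τ := by
    intro τ hτ
    have h1 : HasDerivAt (fun τ => f τ - (τ - t₀) * f' t₀) (f' τ - 1 * f' t₀) τ :=
      (hf τ (hsub hτ)).sub (((hasDerivAt_id τ).sub_const t₀).mul_const _)
    rw [one_mul] at h1
    exact h1.hasDerivWithinAt
  have hbound : ∀ τ ∈ uIcc t₀ t, ‖f' τ - f' t₀‖ ≤ R * |t - t₀| := by
    intro τ hτ
    rw [Real.norm_eq_abs]
    refine (hL τ (hsub hτ)).trans ?_
    have hR0 : 0 ≤ R := (abs_nonneg _).trans (hR t₀ ht₀)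
    exact mul_le_mul_of_nonneg_left (abs_sub_left_of_mem_uIcc hτ) hR0
  have h := Convex.norm_image_sub_le_of_norm_hasDerivWithin_le hg hbound (convex_uIcc _ _)
    left_mem_uIcc right_mem_uIcc
  simp only [Real.norm_eq_abs, sub_self, zero_mul, sub_zero] at h
  have e : f t - f t₀ - (t - t₀) * f' t₀ = f t - (t - t₀) * f' t₀ - f t₀ := by ring
  rw [e]
  calc |f t - (t - t₀) * f' t₀ - f t₀| ≤ R * |t - t₀| * |t - t₀| := h
    _ = R * (t - t₀) ^ 2 := by rw [mul_assoc, ← sq, sq_abs]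

end Scalar

/-! ## 2. Derivatives of `J ↦ ∫ e^{J q} qⁿ dν` for bounded `q` -/

section ExpIntegral

variable {Y : Type*} [MeasurableSpace Y] {ν : Measure Y} [IsFiniteMeasure ν]

/-- **`d/dJ ∫ e^{J q} qⁿ dν = ∫ e^{J q} qⁿ⁺¹ dν`** for a bounded (a.e. strongly measurable) `q` on a
finite measure space (dominated convergence with the majorant `e^{(|J₀|+1)M} Mⁿ⁺¹` on `[J₀-1, J₀+1]`).
[cite: Kato1966, II-§5.4 (differentiability at a point); dominated differentiation folklore] -/
theorem hasDerivAt_integral_exp_mul_pow {q : Y → ℝ} (hq : AEStronglyMeasurable q ν) {M : ℝ}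
    (hM : ∀ y, |q y| ≤ M) (n : ℕ) (J₀ : ℝ) :
    HasDerivAt (fun J => ∫ y, Real.exp (J * q y) * q y ^ n ∂ν)
      (∫ y, Real.exp (J₀ * q y) * q y ^ (n + 1) ∂ν) J₀ := by
  have hs : Icc (J₀ - 1) (J₀ + 1) ∈ 𝓝 J₀ := Icc_mem_nhds (by linarith) (by linarith)
  have hmeas : ∀ (J : ℝ) (k : ℕ),
      AEStronglyMeasurable (fun y => Real.exp (J * q y) * q y ^ k) ν := fun J k =>
    (Real.continuous_exp.comp_aestronglyMeasurable (aestronglyMeasurable_const.mul hq)).mul (hq.pow k)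
  have hbd : ∀ (J : ℝ) (k : ℕ) (y : Y), |J| ≤ |J₀| + 1 →
      ‖Real.exp (J * q y) * q y ^ k‖ ≤ Real.exp ((|J₀| + 1) * M) * M ^ k := by
    intro J k y hJ
    rw [norm_mul, Real.norm_eq_abs, Real.norm_eq_abs, Real.abs_exp, abs_pow]
    refine mul_le_mul ?_ (pow_le_pow_left₀ (abs_nonneg _) (hM y) k) (by positivity)
      (Real.exp_pos _).le
    refine Real.exp_le_exp.mpr ?_
    calc J * q y ≤ |J * q y| := le_abs_self _
      _ = |J| * |q y| := abs_mul _ _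
      _ ≤ (|J₀| + 1) * M := mul_le_mul hJ (hM y) (abs_nonneg _) (by positivity)
  have key := hasDerivAt_integral_of_dominated_loc_of_deriv_le (μ := ν)
    (F := fun J y => Real.exp (J * q y) * q y ^ n)
    (F' := fun J y => Real.exp (J * q y) * q y ^ (n + 1))
    (bound := fun _ => Real.exp ((|J₀| + 1) * M) * M ^ (n + 1)) hs ?_ ?_ ?_ ?_ ?_ ?_
  · exact key.2
  · exact Eventually.of_forall fun J => hmeas J n
  · exact Integrable.of_bound (hmeas J₀ n) (Real.exp ((|J₀| + 1) * M) * M ^ n)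
      (Eventually.of_forall fun y => hbd J₀ n y (by linarith [abs_nonneg J₀]))
  · exact hmeas J₀ (n + 1)
  · refine Eventually.of_forall fun y J hJ => hbd J (n + 1) y ?_
    rcases hJ with ⟨h1, h2⟩
    rw [abs_le]; constructor <;> [linarith [neg_abs_le J₀]; linarith [le_abs_self J₀]]
  · exact integrable_const _
  · refine Eventually.of_forall fun y J _ => ?_
    have h := ((hasDerivAt_mul_const (x := J) (q y)).exp).mul_const (q y ^ n)
    refine h.congr_deriv ?_
    rw [pow_succ]
    ring

/-- The bound `|∫ e^{J q} qⁿ dν| ≤ e^{|J| M} Mⁿ ν(Y)`. [cite: Kato1966, III-§2.1 Example 2.4 (kernel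
bounds)] -/
theorem abs_integral_exp_mul_pow_le {q : Y → ℝ} {M : ℝ} (hM : ∀ y, |q y| ≤ M) (n : ℕ) (J : ℝ) :
    |∫ y, Real.exp (J * q y) * q y ^ n ∂ν| ≤ Real.exp (|J| * M) * M ^ n * ν.real univ := by
  have h := norm_integral_le_of_norm_le_const (μ := ν)
    (f := fun y => Real.exp (J * q y) * q y ^ n) (C := Real.exp (|J| * M) * M ^ n)
    (Eventually.of_forall fun y => ?_)
  · rwa [Real.norm_eq_abs] at h
  · rw [norm_mul, Real.norm_eq_abs, Real.norm_eq_abs, Real.abs_exp, abs_pow]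
    refine mul_le_mul ?_ (pow_le_pow_left₀ (abs_nonneg _) (hM y) n) (by positivity)
      (Real.exp_pos _).le
    refine Real.exp_le_exp.mpr ?_
    calc J * q y ≤ |J * q y| := le_abs_self _
      _ = |J| * |q y| := abs_mul _ _
      _ ≤ |J| * M := mul_le_mul_of_nonneg_left (hM y) (abs_nonneg _)

end ExpIntegral

/-! ## 3. Integral operators: norm bound by the kernel, and the operator-norm derivative -/

section Operator

variable {X : Type*} [MeasurableSpace X] {μ : Measure X} [IsFiniteMeasure μ]

/-- **`‖A‖ ≤ C · μ(X)` for an integral operator whose kernel is bounded by `C`** on `L²` of a finite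
measure space (`|∫ K(x,y)φ(y)| ≤ C √μ(X) ‖φ‖₂` pointwise, then the `L²` norm of a bounded function).
[cite: Kato1966, III-§2.1 Example 2.4 (2.10) (operator norm of an integral operator from kernel bounds)] -/
theorem opNorm_le_of_kernel_bound {A : Lp ℝ 2 μ →L[ℝ] Lp ℝ 2 μ} {K : X → X → ℝ} {C : ℝ}
    (hA : ∀ φ : Lp ℝ 2 μ, (A φ : X → ℝ) =ᵐ[μ] fun x => ∫ y, K x y * φ y ∂μ)
    (hC : ∀ x y, ‖K x y‖ ≤ C) (hC0 : 0 ≤ C) : ‖A‖ ≤ C * μ.real univ := by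
  refine ContinuousLinearMap.opNorm_le_bound _ (by positivity) fun φ => ?_
  have h1 : ∀ᵐ x ∂μ, ‖(A φ : X → ℝ) x‖ ≤ C * Real.sqrt (μ.real univ) * ‖φ‖ := by
    filter_upwards [hA φ] with x hx
    rw [hx, Real.norm_eq_abs]
    exact abs_integral_kernel_mul_le hC hC0 φ x
  have h2 := Lp.norm_le_of_ae_bound (by positivity) h1
  have hm : ((measureUnivNNReal μ : ℝ) ^ (2 : ℝ≥0∞).toReal⁻¹) = Real.sqrt (μ.real univ) := by
    rw [ENNReal.toReal_ofNat, Real.sqrt_eq_rpow, one_div]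
    rfl
  calc ‖A φ‖ ≤ (measureUnivNNReal μ : ℝ) ^ (2 : ℝ≥0∞).toReal⁻¹ * (C * Real.sqrt (μ.real univ) * ‖φ‖) := h2
    _ = C * (Real.sqrt (μ.real univ) * Real.sqrt (μ.real univ)) * ‖φ‖ := by rw [hm]; ring
    _ = C * μ.real univ * ‖φ‖ := by rw [Real.mul_self_sqrt measureReal_nonneg]

/-- **The remainder operator has the remainder kernel**: if `T t`, `T t₀`, `T′` are given a.e. by the
bounded measurable kernels `K t`, `K t₀`, `K′`, then `T t - T t₀ - (t - t₀)•T′` is given a.e. by the kernel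
`K t - K t₀ - (t - t₀) K′`. [cite: Kato1966, II-§5.4 Theorem 5.4 (operator-valued remainder)] -/
theorem kernelOp_taylor_ae_eq {K₁ K₀ K' : X → X → ℝ} {C₁ C₀ C' : ℝ}
    (hK₁ : StronglyMeasurable (uncurry K₁)) (hC₁ : ∀ x y, ‖K₁ x y‖ ≤ C₁)
    (hK₀ : StronglyMeasurable (uncurry K₀)) (hC₀ : ∀ x y, ‖K₀ x y‖ ≤ C₀)
    (hK' : StronglyMeasurable (uncurry K')) (hC' : ∀ x y, ‖K' x y‖ ≤ C')
    {T₁ T₀ T' : Lp ℝ 2 μ →L[ℝ] Lp ℝ 2 μ}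
    (hT₁ : ∀ φ : Lp ℝ 2 μ, (T₁ φ : X → ℝ) =ᵐ[μ] fun x => ∫ y, K₁ x y * φ y ∂μ)
    (hT₀ : ∀ φ : Lp ℝ 2 μ, (T₀ φ : X → ℝ) =ᵐ[μ] fun x => ∫ y, K₀ x y * φ y ∂μ)
    (hT' : ∀ φ : Lp ℝ 2 μ, (T' φ : X → ℝ) =ᵐ[μ] fun x => ∫ y, K' x y * φ y ∂μ) (h : ℝ)
    (φ : Lp ℝ 2 μ) :
    ((T₁ - T₀ - h • T') φ : X → ℝ) =ᵐ[μ]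
      fun x => ∫ y, (K₁ x y - K₀ x y - h * K' x y) * φ y ∂μ := by
  have e : (T₁ - T₀ - h • T') φ = T₁ φ - T₀ φ - h • T' φ := rfl
  rw [e]
  filter_upwards [Lp.coeFn_sub (T₁ φ - T₀ φ) (h • T' φ), Lp.coeFn_sub (T₁ φ) (T₀ φ),
    Lp.coeFn_smul h (T' φ), hT₁ φ, hT₀ φ, hT' φ] with x hx1 hx2 hx3 h1 h0 h'
  rw [hx1, Pi.sub_apply, hx2, Pi.sub_apply, hx3, Pi.smul_apply, h1, h0, h', smul_eq_mul]
  have i1 := integrable_kernel_mul_coeFn (μ := μ) hK₁ hC₁ φ x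
  have i0 := integrable_kernel_mul_coeFn (μ := μ) hK₀ hC₀ φ x
  have i' := integrable_kernel_mul_coeFn (μ := μ) hK' hC' φ x
  have i10 : Integrable (fun y => K₁ x y * φ y - K₀ x y * φ y) μ := i1.sub i0
  have ih : Integrable (fun y => h * (K' x y * φ y)) μ := i'.const_mul h
  have s1 : ∫ y, (K₁ x y - K₀ x y - h * K' x y) * φ y ∂μ =
      ∫ y, (K₁ x y * φ y - K₀ x y * φ y) - h * (K' x y * φ y) ∂μ := by
    refine integral_congr_ae (Eventually.of_forall fun y => ?_)
    ring
  rw [s1, integral_sub i10 ih, integral_sub i1 i0, integral_const_mul]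

/-- **Operator-norm differentiability of a kernel family from a second-order bound on the kernels.**
Let `T t` (`t ∈ [t₀ - r, t₀ + r]`, `r > 0`) and `T′` be bounded operators on `L²(X, μ)` (`μ` finite)
given a.e. by bounded, jointly measurable kernels `K t` and `K′`, and suppose
`|K t (x,y) - K t₀ (x,y) - (t - t₀) K′(x,y)| ≤ R (t - t₀)²` for all `x, y` and all such `t`. Then
`HasDerivAt T T′ t₀` in operator norm (the remainder operator has norm `≤ R μ(X) (t - t₀)² = o(t - t₀)`).
[cite: Kato1966, II-§5.4 Theorem 5.4 (differentiability at a point, operator-valued o(ϰ)); III-§2.1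
Example 2.4 (kernel bounds)] -/
theorem hasDerivAt_kernelOp_of_remainder_bound {K : ℝ → X → X → ℝ} {K' : X → X → ℝ}
    {t₀ r C C' R : ℝ} (hr : 0 < r)
    (hK : ∀ t ∈ Icc (t₀ - r) (t₀ + r), StronglyMeasurable (uncurry (K t)))
    (hC : ∀ t ∈ Icc (t₀ - r) (t₀ + r), ∀ x y, ‖K t x y‖ ≤ C)
    (hK' : StronglyMeasurable (uncurry K')) (hC' : ∀ x y, ‖K' x y‖ ≤ C')
    (hrem : ∀ t ∈ Icc (t₀ - r) (t₀ + r), ∀ x y,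
      ‖K t x y - K t₀ x y - (t - t₀) * K' x y‖ ≤ R * (t - t₀) ^ 2)
    {T : ℝ → Lp ℝ 2 μ →L[ℝ] Lp ℝ 2 μ} {T' : Lp ℝ 2 μ →L[ℝ] Lp ℝ 2 μ}
    (hT : ∀ t ∈ Icc (t₀ - r) (t₀ + r), ∀ φ : Lp ℝ 2 μ,
      (T t φ : X → ℝ) =ᵐ[μ] fun x => ∫ y, K t x y * φ y ∂μ)
    (hT' : ∀ φ : Lp ℝ 2 μ, (T' φ : X → ℝ) =ᵐ[μ] fun x => ∫ y, K' x y * φ y ∂μ) :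
    HasDerivAt T T' t₀ := by
  have ht₀ : t₀ ∈ Icc (t₀ - r) (t₀ + r) := ⟨by linarith, by linarith⟩
  -- replace `R` by `R⁺ = max R 0 ≥ 0`
  set R' : ℝ := max R 0 with hR'def
  have hR' : 0 ≤ R' := le_max_right _ _
  have hrem' : ∀ t ∈ Icc (t₀ - r) (t₀ + r), ∀ x y,
      ‖K t x y - K t₀ x y - (t - t₀) * K' x y‖ ≤ R' * (t - t₀) ^ 2 := fun t ht x y =>
    (hrem t ht x y).trans (mul_le_mul_of_nonneg_right (le_max_left _ _) (sq_nonneg _))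
  -- the remainder operator has norm `≤ R⁺ μ(X) (t - t₀)²` on the interval
  have hnorm : ∀ t ∈ Icc (t₀ - r) (t₀ + r), ‖T t - T t₀ - (t - t₀) • T'‖ ≤
      R' * (t - t₀) ^ 2 * μ.real univ := by
    intro t ht
    exact opNorm_le_of_kernel_bound
      (kernelOp_taylor_ae_eq (hK t ht) (hC t ht) (hK t₀ ht₀) (hC t₀ ht₀) hK' hC'
        (hT t ht) (hT t₀ ht₀) hT' (t - t₀)) (fun x y => hrem' t ht x y) (by positivity)
  -- conclude
  rw [hasDerivAt_iff_isLittleO]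
  refine IsBigO.trans_isLittleO (g := fun t => ‖t - t₀‖ ^ 2) ?_ (isLittleO_pow_sub_sub t₀ one_lt_two)
  refine IsBigO.of_bound (R' * μ.real univ) ?_
  filter_upwards [Icc_mem_nhds (show t₀ - r < t₀ by linarith) (show t₀ < t₀ + r by linarith)]
    with t ht
  rw [Real.norm_of_nonneg (by positivity), Real.norm_eq_abs, sq_abs]
  calc ‖T t - T t₀ - (t - t₀) • T'‖ ≤ R' * (t - t₀) ^ 2 * μ.real univ := hnorm t ht
    _ = R' * μ.real univ * (t - t₀) ^ 2 := by ring

/-- **Operator-norm differentiability from kernel derivatives**: if for every `(x, y)` the function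
`t ↦ K t (x,y)` has derivative `∂K t (x,y)` and `t ↦ ∂K t (x,y)` has derivative `∂²K t (x,y)` on
`[t₀ - r, t₀ + r]` with `|∂²K| ≤ R` there, and `T t`, `T′` are operators with the (bounded, jointly
measurable) kernels `K t`, `∂K t₀`, then `HasDerivAt T T′ t₀`. [cite: Kato1966, II-§5.4 Theorem 5.4
(differentiability at a point); III-§2.1 Example 2.4] -/
theorem hasDerivAt_kernelOp_of_abs_deriv_two_le {K dK d2K : ℝ → X → X → ℝ}
    {t₀ r C C' R : ℝ} (hr : 0 < r)
    (hK : ∀ t ∈ Icc (t₀ - r) (t₀ + r), StronglyMeasurable (uncurry (K t)))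
    (hC : ∀ t ∈ Icc (t₀ - r) (t₀ + r), ∀ x y, ‖K t x y‖ ≤ C)
    (hK' : StronglyMeasurable (uncurry (dK t₀))) (hC' : ∀ x y, ‖dK t₀ x y‖ ≤ C')
    (hd : ∀ t ∈ Icc (t₀ - r) (t₀ + r), ∀ x y, HasDerivAt (fun τ => K τ x y) (dK t x y) t)
    (hd2 : ∀ t ∈ Icc (t₀ - r) (t₀ + r), ∀ x y, HasDerivAt (fun τ => dK τ x y) (d2K t x y) t)
    (hR : ∀ t ∈ Icc (t₀ - r) (t₀ + r), ∀ x y, |d2K t x y| ≤ R)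
    {T : ℝ → Lp ℝ 2 μ →L[ℝ] Lp ℝ 2 μ} {T' : Lp ℝ 2 μ →L[ℝ] Lp ℝ 2 μ}
    (hT : ∀ t ∈ Icc (t₀ - r) (t₀ + r), ∀ φ : Lp ℝ 2 μ,
      (T t φ : X → ℝ) =ᵐ[μ] fun x => ∫ y, K t x y * φ y ∂μ)
    (hT' : ∀ φ : Lp ℝ 2 μ, (T' φ : X → ℝ) =ᵐ[μ] fun x => ∫ y, dK t₀ x y * φ y ∂μ) :
    HasDerivAt T T' t₀ :=
  hasDerivAt_kernelOp_of_remainder_bound hr hK hC hK' hC'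
    (fun t ht x y => by
      rw [Real.norm_eq_abs]
      exact abs_sub_sub_mul_le_of_abs_deriv_two_le (f := fun τ => K τ x y) (f' := fun τ => dK τ x y)
        (f'' := fun τ => d2K τ x y) (fun τ hτ => hd τ hτ x y) (fun τ hτ => hd2 τ hτ x y)
        (fun τ hτ => hR τ hτ x y) ht)
    hT hT'

end Operator

end Literature.Analysis.OperatorTheory

end
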